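import Mathlib
import HarnessLib
import Summits.HubbardSuperconductivity.HubbardSuperconductivity.Theorems.KLProgrammeKLRegimeTwoVolumeTowerBudgetLaws

/-!
# Route `KLProgramme` — crux K3, VL child `KLRegimeVolumeLimitV17F3` (stmt-HubbardSuperconductivity-23356), cure (c1) of «(VL)-HE1-LEVEL0-DEG2», consumer side:
# THE PROFILE BUDGET UNDER ONE GEOMETRIC MAJORANT WITH A FREE ALIVE DEGREE-2 VALUE (seat hubbard-kl-k3c4-p1 g20, VL lead; `--supports` 23356)

`…TowerBudgetGeom.towerBudget_le_geom` / `…TowerBudgetLaws.towerBudgetConst_le_laws` majorise the one-volume profile budget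
`NV j m = S₀ j (2m) + t·S j 1 (2m) + t²·S j 2 (2m)` by `A_j·q_j^m` when E1's alive read-out obeys its law in EVERY degree `2m ≥ 2`.  Under the re-typed
`stub_vl_HE1free′` (degree-2 law at `ε_{n_β+1}`; VL lead g20's pick (c1)) the degree-2 alive value is a free number `a₂ ≥ 0` (`= C₀·Q.CE·εb·4^{−(j+1)}`, `εb ≥ ε_{j+1}`):
* `towerBudget_le_geom'` — the same majorant with the extra summand `a₂/q` in the constant (law asked only for `2m ≥ 4`);
* `towerBudgetConst_le_laws'` — the constant is `≤ εb·32^{−j}·(2K)` with the landed `K` (`a₂/q = εb·32^{−j}·C₀·Q.CE·Dq/4 ≤ εb·32^{−j}·K`).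
Real arithmetic only; nothing about the model is asserted. [cite: BenfattoGiulianiMastropietro2006, §2.8 (2.83)]
-/

noncomputable section

namespace Summit.HubbardSuperconductivity.HubbardSuperconductivity.Theorems.TwoVolumeSource

set_option linter.dupNamespace false -- summit = problem name (single-conjunct summit), D-0017

open Finset Literature.MathematicalPhysics.QuantumLattice Literature.Probability.LatticeModels
open Summit.HubbardSuperconductivity.HubbardSuperconductivity.Theorems.KLRegimeSplit
open Summit.HubbardSuperconductivity.HubbardSuperconductivity.Theorems.EngineV8

/-- **The profile budget under one geometric majorant, alive law only in degrees `≥ 4`, free degree-2 alive value `a₂`.**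
[cite: BenfattoGiulianiMastropietro2006, §2.8 (2.83)] -/
theorem towerBudget_le_geom' (P : SplitConsts) (Q Q' : EngConsts) (U : ℝ) (n : ℕ) (hCE : 0 ≤ Q.CE) (hCE' : 0 ≤ Q'.CE) (hε : 0 < epsCoupling P U n)
    {q : ℝ} (hq0 : 0 < q) (hq : Q.CE * epsCoupling P U n * 8 ^ n ≤ q) (hq' : Q'.CE * epsCoupling P U n * 8 ^ n ≤ q)
    {C₀ τ a₂ : ℝ} (hC₀ : 0 ≤ C₀) (hτ : 0 ≤ τ) (ha₂ : 0 ≤ a₂) (S₀ : ℕ → ℝ)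
    (hS₀ : ∀ m, 2 ≤ m → S₀ (2 * m) ≤ C₀ * klWtBudget P Q U n (2 * m)) (hS₀two : S₀ 2 ≤ a₂) {m : ℕ} (hm : 1 ≤ m) :
    S₀ (2 * m) + τ * (if 2 * m ≤ 2 then 1 else klWtBudget P Q' U n (2 * m)) ≤
      (((32 : ℝ) ^ n)⁻¹ * C₀ * (Q.CE * epsCoupling P U n * 8 ^ n / q + (epsCoupling P U n)⁻¹ * (Q.CE * epsCoupling P U n * 8 ^ n / q) ^ 2) + a₂ / q + τ / q +
        τ * (((32 : ℝ) ^ n)⁻¹ * (Q'.CE * epsCoupling P U n * 8 ^ n / q + (epsCoupling P U n)⁻¹ * (Q'.CE * epsCoupling P U n * 8 ^ n / q) ^ 2))) * q ^ m := by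
  have hqm : 0 < q ^ m := pow_pos hq0 m
  have hA₁ : 0 ≤ ((32 : ℝ) ^ n)⁻¹ * C₀ * (Q.CE * epsCoupling P U n * 8 ^ n / q + (epsCoupling P U n)⁻¹ * (Q.CE * epsCoupling P U n * 8 ^ n / q) ^ 2) := by
    have := hε.le; positivity
  have hA₂ : 0 ≤ τ / q := div_nonneg hτ hq0.le
  have hA₄ : 0 ≤ a₂ / q := div_nonneg ha₂ hq0.le
  have hA₃ : 0 ≤ τ * (((32 : ℝ) ^ n)⁻¹ * (Q'.CE * epsCoupling P U n * 8 ^ n / q + (epsCoupling P U n)⁻¹ * (Q'.CE * epsCoupling P U n * 8 ^ n / q) ^ 2)) := by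
    have := hε.le; positivity
  -- the alive piece: degree 2 from `a₂`, degrees ≥ 4 from the law
  have h₀ : S₀ (2 * m) ≤ (((32 : ℝ) ^ n)⁻¹ * C₀ * (Q.CE * epsCoupling P U n * 8 ^ n / q + (epsCoupling P U n)⁻¹ * (Q.CE * epsCoupling P U n * 8 ^ n / q) ^ 2) +
      a₂ / q) * q ^ m := by
    rcases Nat.lt_or_ge m 2 with hm1 | hm2
    · obtain rfl : m = 1 := by omega
      rw [pow_one, add_mul, div_mul_cancel₀ _ hq0.ne']
      exact hS₀two.trans (le_add_of_nonneg_left (mul_nonneg hA₁ hq0.le))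
    · refine (hS₀ m hm2).trans ?_
      have h := mul_le_mul_of_nonneg_left (klWtBudget_two_mul_le_geom P Q U n hCE hε hq0 hq hm) hC₀
      refine h.trans ?_
      rw [add_mul]
      refine le_trans (le_of_eq ?_) (le_add_of_nonneg_right (mul_nonneg hA₄ hqm.le))
      ring
  -- the source piece (verbatim)
  have h₁ : τ * (if 2 * m ≤ 2 then 1 else klWtBudget P Q' U n (2 * m)) ≤
      (τ / q + τ * (((32 : ℝ) ^ n)⁻¹ * (Q'.CE * epsCoupling P U n * 8 ^ n / q + (epsCoupling P U n)⁻¹ * (Q'.CE * epsCoupling P U n * 8 ^ n / q) ^ 2))) * q ^ m := by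
    split_ifs with h2
    · obtain rfl : m = 1 := by omega
      rw [mul_one, pow_one, add_mul, div_mul_cancel₀ _ hq0.ne']
      exact le_add_of_nonneg_right (mul_nonneg hA₃ hq0.le)
    · have h := mul_le_mul_of_nonneg_left (klWtBudget_two_mul_le_geom P Q' U n hCE' hε hq0 hq' hm) hτ
      rw [add_mul]
      refine h.trans ?_
      rw [← mul_assoc]
      exact le_add_of_nonneg_left (mul_nonneg hA₂ hqm.le)
  calc S₀ (2 * m) + τ * (if 2 * m ≤ 2 then 1 else klWtBudget P Q' U n (2 * m))
      ≤ (((32 : ℝ) ^ n)⁻¹ * C₀ * (Q.CE * epsCoupling P U n * 8 ^ n / q + (epsCoupling P U n)⁻¹ * (Q.CE * epsCoupling P U n * 8 ^ n / q) ^ 2) + a₂ / q) * q ^ m +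
        (τ / q + τ * (((32 : ℝ) ^ n)⁻¹ * (Q'.CE * epsCoupling P U n * 8 ^ n / q + (epsCoupling P U n)⁻¹ * (Q'.CE * epsCoupling P U n * 8 ^ n / q) ^ 2))) * q ^ m :=
        add_le_add h₀ h₁
    _ = _ := by ring

/-- **The constant of `towerBudget_le_geom'` against the laws**: with `a₂ := C₀·Q.CE·εb·4^{−(j+1)}`, `εb ≥ ε_{j+1}`, `0 ≤ C₀`, it is
`≤ εb·32^{−j}·(2K)`, `K` the landed constant of `towerBudgetConst_le_laws`. [folklore] -/
theorem towerBudgetConst_le_laws' (P : SplitConsts) (Q Q' : EngConsts) (U : ℝ) (j : ℕ) (hCE : 0 ≤ Q.CE) (hCE' : 0 ≤ Q'.CE)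
    (hε : 0 < epsCoupling P U (j + 1)) {εb : ℝ} (hεb : epsCoupling P U (j + 1) ≤ εb) {Dq : ℝ} (hDq : 0 < Dq) {C₀ : ℝ} (hC₀ : 0 ≤ C₀)
    {q τ : ℝ} (hq : q = (8 : ℝ) ^ j / Dq) (hτ : τ = Q.CE * epsCoupling P U (j + 1) * ((4 : ℝ) ^ (j + 1))⁻¹) :
    ((32 : ℝ) ^ (j + 1))⁻¹ * C₀ * (Q.CE * epsCoupling P U (j + 1) * 8 ^ (j + 1) / q +
        (epsCoupling P U (j + 1))⁻¹ * (Q.CE * epsCoupling P U (j + 1) * 8 ^ (j + 1) / q) ^ 2) +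
      C₀ * Q.CE * εb * ((4 : ℝ) ^ (j + 1))⁻¹ / q + τ / q +
      τ * (((32 : ℝ) ^ (j + 1))⁻¹ * (Q'.CE * epsCoupling P U (j + 1) * 8 ^ (j + 1) / q +
        (epsCoupling P U (j + 1))⁻¹ * (Q'.CE * epsCoupling P U (j + 1) * 8 ^ (j + 1) / q) ^ 2)) ≤
      εb * ((32 : ℝ) ^ j)⁻¹ *
        (2 * (Q.CE * Dq / 4 * (C₀ * (1 + 8 * Q.CE * Dq) + 1 + εb * Q'.CE * (1 + 8 * Q'.CE * Dq) / 4))) := by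
  have hε0 := hε.le
  have hεb0 : 0 ≤ εb := hε0.trans hεb
  have h := towerBudgetConst_le_laws P Q Q' U j hCE hCE' hε hεb hDq (C₀ := C₀) hq hτ
  -- the extra term: `a₂/q = εb·32^{−j}·C₀·Q.CE·Dq/4`
  have h32 : ((32 : ℝ) ^ j)⁻¹ = ((8 : ℝ) ^ j)⁻¹ * ((4 : ℝ) ^ j)⁻¹ := by
    rw [← mul_inv, ← mul_pow]; norm_num
  have hextra : C₀ * Q.CE * εb * ((4 : ℝ) ^ (j + 1))⁻¹ / q = εb * ((32 : ℝ) ^ j)⁻¹ * (C₀ * Q.CE * Dq / 4) := by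
    rw [hq, h32, pow_succ]
    field_simp
  have hK0 : 0 ≤ Q.CE * Dq / 4 * (C₀ * (1 + 8 * Q.CE * Dq) + 1 + εb * Q'.CE * (1 + 8 * Q'.CE * Dq) / 4) := by positivity
  have hextra_le : C₀ * Q.CE * Dq / 4 ≤ Q.CE * Dq / 4 * (C₀ * (1 + 8 * Q.CE * Dq) + 1 + εb * Q'.CE * (1 + 8 * Q'.CE * Dq) / 4) := by
    have h1 : C₀ * Q.CE * Dq / 4 = Q.CE * Dq / 4 * C₀ := by ring
    rw [h1]
    refine mul_le_mul_of_nonneg_left ?_ (by positivity)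
    have h2 : C₀ ≤ C₀ * (1 + 8 * Q.CE * Dq) := le_mul_of_one_le_right hC₀ (by nlinarith [mul_nonneg hCE hDq.le])
    have h3 : 0 ≤ εb * Q'.CE * (1 + 8 * Q'.CE * Dq) / 4 := by positivity
    linarith
  have hmid : εb * ((32 : ℝ) ^ j)⁻¹ * (C₀ * Q.CE * Dq / 4) ≤
      εb * ((32 : ℝ) ^ j)⁻¹ * (Q.CE * Dq / 4 * (C₀ * (1 + 8 * Q.CE * Dq) + 1 + εb * Q'.CE * (1 + 8 * Q'.CE * Dq) / 4)) :=
    mul_le_mul_of_nonneg_left hextra_le (by positivity)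
  have hmain := h
  calc _ = (((32 : ℝ) ^ (j + 1))⁻¹ * C₀ * (Q.CE * epsCoupling P U (j + 1) * 8 ^ (j + 1) / q +
            (epsCoupling P U (j + 1))⁻¹ * (Q.CE * epsCoupling P U (j + 1) * 8 ^ (j + 1) / q) ^ 2) + τ / q +
          τ * (((32 : ℝ) ^ (j + 1))⁻¹ * (Q'.CE * epsCoupling P U (j + 1) * 8 ^ (j + 1) / q +
            (epsCoupling P U (j + 1))⁻¹ * (Q'.CE * epsCoupling P U (j + 1) * 8 ^ (j + 1) / q) ^ 2))) +
          C₀ * Q.CE * εb * ((4 : ℝ) ^ (j + 1))⁻¹ / q := by ring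
    _ ≤ epsCoupling P U (j + 1) * ((32 : ℝ) ^ j)⁻¹ * (Q.CE * Dq / 4 * (C₀ * (1 + 8 * Q.CE * Dq) + 1 + εb * Q'.CE * (1 + 8 * Q'.CE * Dq) / 4)) +
          εb * ((32 : ℝ) ^ j)⁻¹ * (C₀ * Q.CE * Dq / 4) := by rw [hextra]; exact add_le_add hmain le_rfl
    _ ≤ εb * ((32 : ℝ) ^ j)⁻¹ * (Q.CE * Dq / 4 * (C₀ * (1 + 8 * Q.CE * Dq) + 1 + εb * Q'.CE * (1 + 8 * Q'.CE * Dq) / 4)) +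
          εb * ((32 : ℝ) ^ j)⁻¹ * (Q.CE * Dq / 4 * (C₀ * (1 + 8 * Q.CE * Dq) + 1 + εb * Q'.CE * (1 + 8 * Q'.CE * Dq) / 4)) :=
        add_le_add (mul_le_mul_of_nonneg_right (mul_le_mul_of_nonneg_right hεb (by positivity)) hK0) hmid
    _ = _ := by ring

end Summit.HubbardSuperconductivity.HubbardSuperconductivity.Theorems.TwoVolumeSource

end
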